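import Summits.BirchSwinnertonDyer.BirchSwinnertonDyer.Theorems.GenusKolyvaginAtTwoK4NegPhantomDeepTwistPersistencePFrame
import Literature.NumberTheory.EllipticCurves.TwoAdicImageQuadraticTwistProofs
import Literature.NumberTheory.EllipticCurves.ExceptionalPrimesDensityModels
import Literature.NumberTheory.EllipticCurves.BSDRankZeroDensityProofs
import HarnessLib

/-!
# Route `GenusKolyvaginAtTwo`, crux K₄⁻ `K4Neg` (stmt-BirchSwinnertonDyer-31526), the (β)/𝒫-frames — PHANTOM PERSISTENCE UNDER DEEP TWISTING, part 3:
# a deep twist of Mordell–Weil rank `0` has NON-TRIVIAL `Ш[2]` — the phantom is a genuine Tate–Shafarevich class of the even genus partner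

Seat `bsd-line-gk2-p3` g35 (PROVER seat 3/3, cell `bsd-f1-sign2`), sequel of `…K4NegPhantomDeepTwistPersistence{,PFrame}` (p792861, p793066),
`--supports stmt-BirchSwinnertonDyer-31526 --as helper`.  THEOREMS ONLY (no definition, no named fact, no `sorry`); standard axioms; UNCONDITIONAL.
**BSD is NOT proved by this file; K4Neg is neither proved nor refuted by it; nothing is closed.**

WHY.  The genus–Gross–Zagier verdict (memo `K4NEG-BETA-GENUS-VERDICT-gk2p3-g35.md` §4) consumes, at every deep level `n`, «the rank-`0` member `E⁰` of the genus pair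
`(E^{(D_n)}, E^{(−ℓ₀D_n)})` has `Ш(E⁰)[2] ≠ 0`».  Parts 1–2 give `#Sel₂ ≥ 2` for BOTH members; this file converts that into the `Ш` statement for whichever member has
Mordell–Weil rank `0`, using the tree's exact descent count `#Sel^(n) = n^{rank}·#E(ℚ)[n]·#Ш[n]` (Silverman X.4.2, `natCard_selmerGroup_eq`) and the twist-invariance of
«`ρ̄_{E,2}` onto» (Dokchitser–Dokchitser (1)), which kills the rational `2`-torsion of every model of every twist.

WHAT.
* §1 `two_le_natCard_sha_inf_torsionBy_of_hasSurjectiveModNGaloisRep_two` (any number field) — `ρ̄₂` onto + rank `0` + `#Sel₂ ≥ 2` ⟹ `#(Ш ⊓ H¹[2]) ≥ 2`;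
  `hasSurjectiveModNGaloisRep_two_of_smul_quadraticTwist` — `ρ̄_{W,2}` onto passes to every model of every quadratic twist.
* §2 ★★★ `two_le_natCard_sha_twist_of_phantom_selmer_of_kolyvaginPrimes` / `…_frameTwist_…` — on the phantom cell (resp. on a 𝒫-frame), every model of `W^{(D)}`
  (resp. `W^{(−ℓ₀D)}`), `D ≡ 1 (8)` with K4Neg-deep odd prime factors, of Mordell–Weil rank `0` has `#(Ш ⊓ H¹[2]) ≥ 2`: the Lawson–Wuthrich phantom is a non-trivial
  element of `Ш[2]` of the even genus partner at every deep level.  (memo (★): each such class costs the Heegner `χ_n`-vector one more halving.)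

References: [SilvermanAEC2009] Thm. X.4.2; [DokchitserDokchitserMathZ2012] Thm. (1); [MazurRubin2010] Lemma 3.2; [LawsonWuthrich2016] §7.1.
-/

set_option linter.dupNamespace false -- tree convention: `Summit.BirchSwinnertonDyer.BirchSwinnertonDyer.Theorems` (summit = sub-problem)
set_option autoImplicit false

noncomputable section

open scoped Classical NumberField AddSubgroup

namespace Summit.BirchSwinnertonDyer.BirchSwinnertonDyer.Theorems.GenusExact.PhantomDescentBit.DeepTwist

open WeierstrassCurve Field NumberField IsDedekindDomain
open Literature.NumberTheory.EllipticCurves Literature.NumberTheory.GaloisRepresentations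

/-! ## §1 Surjectivity mod `2` passes to every twist model; rank-`0` descent count -/

section General

variable {L : Type} [Field L] [NumberField L] (X : WeierstrassCurve L) [X.IsElliptic]

/-- **`ρ̄_{X,2}` onto, Mordell–Weil rank `0`, `#Sel₂ ≥ 2` ⟹ `#(Ш ⊓ H¹[2]) ≥ 2`** (any number field): surjectivity mod `2` excludes rational points of order `2`
(Dokchitser–Dokchitser (1), `forall_two_nsmul_of_hasSurjectiveModNGaloisRep_two`), so `E(L)[2] = 0`, and the exact descent count
`#Sel^(2) = 2^{rank}·#E(L)[2]·#(Ш ⊓ H¹[2])` (Silverman X.4.2, tree `natCard_selmerGroup_eq`) reads `#Sel₂ = #(Ш ⊓ H¹[2])`.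
[cite: SilvermanAEC2009, Thm. X.4.2] [cite: DokchitserDokchitserMathZ2012, Theorem (1)] -/
theorem two_le_natCard_sha_inf_torsionBy_of_hasSurjectiveModNGaloisRep_two (hs : X.HasSurjectiveModNGaloisRep 2)
    (hr : X.mordellWeilRank = 0) (hS : 2 ≤ Nat.card (X.selmerGroup 2)) :
    2 ≤ Nat.card (X.sha ⊓ AddSubgroup.torsionBy X.galH1 2 : AddSubgroup X.galH1) := by
  have hbot : X.toAffine.Point[((2 : ℕ) : ℤ)] = ⊥ := by
    refine (AddSubgroup.eq_bot_iff_forall _).mpr fun P hP ↦ ?_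
    have h2Z : ((2 : ℕ) : ℤ) • P = 0 := (Submodule.mem_torsionBy_iff ((2 : ℕ) : ℤ) P).mp hP
    have h2P : 2 • P = 0 := by rwa [natCast_zsmul] at h2Z
    exact DokchitserDokchitser2012.forall_two_nsmul_of_hasSurjectiveModNGaloisRep_two X two_ne_zero hs P h2P
  have ht : Nat.card (X.toAffine.Point[((2 : ℕ) : ℤ)]) = 1 := by
    rw [hbot, AddSubgroup.card_bot]
  have h := X.natCard_selmerGroup_eq (n := 2) two_ne_zero
  rw [hr, pow_zero, one_mul, ht, one_mul] at h
  have hS' : 2 ≤ Nat.card (X.selmerGroup ((2 : ℕ) : ℤ)) := hS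
  rwa [h] at hS'

end General

variable (W : WeierstrassCurve ℚ) [W.IsElliptic]

/-- **`ρ̄_{W,2}` onto ⟹ `ρ̄_{Wd,2}` onto for every model `Wd = C • W^{(D)}` of every quadratic twist** (Dokchitser–Dokchitser (1): twist-invariance
`hasSurjectiveModNGaloisRep_two_quadraticTwist_iff` and model-invariance `hasSurjectiveModNGaloisRep_smul_iff`). [cite: DokchitserDokchitserMathZ2012, Theorem (1)] -/
theorem hasSurjectiveModNGaloisRep_two_of_smul_quadraticTwist (hsurj : W.HasSurjectiveModNGaloisRep 2) {D : ℚ} (hD : D ≠ 0)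
    (Wd : WeierstrassCurve ℚ) {C : VariableChange ℚ} (hWd : C • W.quadraticTwist D = Wd) :
    Wd.HasSurjectiveModNGaloisRep 2 := by
  rw [← hWd, hasSurjectiveModNGaloisRep_smul_iff]
  exact (hasSurjectiveModNGaloisRep_two_quadraticTwist_iff W hD).mpr hsurj

/-! ## §2 ★★★ The phantom is a non-trivial `Ш[2]`-class of every rank-`0` deep twist -/

variable [W.IsGloballyMinimal] [NeZero (W.conductorNorm ℤ)]

/-- ★★★ **ON THE PHANTOM CELL, EVERY DEEP TWIST OF MORDELL–WEIL RANK `0` HAS `Ш[2] ≠ 0`.**  `E = W/ℚ` globally minimal, `C(W)` odd, off the cut, `Δ < 0`, `ρ̄_{W,2}`,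
`ρ_{W,4}` onto, the Lawson–Wuthrich class `ξ` Selmer; `K` any number field; `D ≠ 0`, `D ≡ 1 (8)`, every odd prime factor K4Neg-deep (`ℓ ∤ N_W`, `FrobEqFrobInfty W K 2 ℓ`,
`2 ≤ kolyvaginIndex W 2 ℓ`); `Wd` any elliptic model of `W^{(D)}` with `rank Wd(ℚ) = 0`.  Then `#(Ш(Wd) ⊓ H¹(ℚ, Wd)[2]) ≥ 2`.  (Part 1 §3 + §1.)
READING (memo §4): at a deep level `n` where `E^{(D_n)}` is the rank-`0` member, the phantom is a genuine Tate–Shafarevich class of it; by Gross–Zagier for `χ_n` × BSD₂ it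
costs the Heegner `χ_n`-vector one halving beyond `2^{ω(n)}`, which is exactly what `P(n) ∉ 2E(K[n])` cannot afford.  BSD is NOT proved by this.
[cite: SilvermanAEC2009, Thm. X.4.2] [cite: DokchitserDokchitserMathZ2012, Theorem (1)] [cite: MazurRubin2010, Lemma 3.2] [cite: LawsonWuthrich2016, §7.1] -/
theorem two_le_natCard_sha_twist_of_phantom_selmer_of_kolyvaginPrimes {K : Type} [Field K] [NumberField K]
    (hT : Odd W.tamagawaProduct)
    (hoff : ¬ ∃ v : HeightOneSpectrum (𝓞 ℚ), ((2 : ℕ) : 𝓞 ℚ) ∉ v.asIdeal ∧ ((W.conductorNorm ℤ : ℕ) : 𝓞 ℚ) ∈ v.asIdeal ∧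
      W.HasMultiplicativeReductionAt v)
    (hΔ : W.Δ < 0) (hsurj : W.HasSurjectiveModNGaloisRep 2) (hsurj4 : W.HasSurjectiveModNGaloisRep 4)
    {ξ : galH1Torsion W (2 : ℤ)} (hξ0 : ξ ≠ 0) (hξ4 : ∀ h ∈ torsionFixing W (4 : ℤ), h1Eval W (2 : ℤ) ξ h = 0)
    (hξS : ξ ∈ W.selmerGroup 2)
    {D : ℤ} (hD : D ≠ 0) (h8 : (8 : ℤ) ∣ D - 1)
    (hdeep : ∀ (ℓ : ℕ), ℓ.Prime → ℓ ≠ 2 → (ℓ : ℤ) ∣ D →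
      ¬ ℓ ∣ W.conductorNorm ℤ ∧ FrobEqFrobInfty W K 2 ℓ ∧ 2 ≤ Zhang2014.kolyvaginIndex W 2 ℓ)
    (Wd : WeierstrassCurve ℚ) [Wd.IsElliptic] {C : VariableChange ℚ} (hWd : C • W.quadraticTwist (D : ℚ) = Wd)
    (hr : Wd.mordellWeilRank = 0) :
    2 ≤ Nat.card (Wd.sha ⊓ AddSubgroup.torsionBy Wd.galH1 2 : AddSubgroup Wd.galH1) := by
  have hD0 : (D : ℚ) ≠ 0 := by exact_mod_cast hD
  exact two_le_natCard_sha_inf_torsionBy_of_hasSurjectiveModNGaloisRep_two Wd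
    (hasSurjectiveModNGaloisRep_two_of_smul_quadraticTwist W hsurj hD0 Wd hWd) hr
    (two_le_natCard_selmerGroup_twist_of_phantom_selmer_of_kolyvaginPrimes W hT hoff hΔ hsurj hsurj4 hξ0 hξ4 hξS hD Wd hWd
      (Or.inl h8) hdeep)

/-- ★★★ **ON A 𝒫-FRAME, THE `−ℓ₀`-TWISTED PARTNER OF MORDELL–WEIL RANK `0` HAS `Ш[2] ≠ 0` TOO.**  Same cell data; `K` imaginary quadratic with odd `d_K = −ℓ₀`
(`ℓ₀` prime), Heegner for `N_W`, `2` split; 𝒫: `4 ∣ a_{ℓ₀}(W)`; `D ≠ 0`, `D ≡ 1 (8)`, odd prime factors K4Neg-deep and `≠ ℓ₀`; `Wd'` any elliptic model of `W^{(−ℓ₀D)}`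
with `rank Wd'(ℚ) = 0`.  Then `#(Ш(Wd') ⊓ H¹(ℚ, Wd')[2]) ≥ 2`.  (Part 2 + §1.)  With the previous theorem: whichever member of the deep genus pair
`(E^{(D_n)}, E^{(−ℓ₀D_n)})` has rank `0` carries the phantom in `Ш[2]`.  BSD is NOT proved by this; K4Neg is neither proved nor refuted here.
[cite: SilvermanAEC2009, Thm. X.4.2] [cite: DokchitserDokchitserMathZ2012, Theorem (1)] [cite: GrossLMS1991, §9 Prop. 9.6] [cite: LawsonWuthrich2016, §7.1] -/
theorem two_le_natCard_sha_frameTwist_of_phantom_selmer_of_kolyvaginPrimes {K : Type} [Field K] [NumberField K]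
    (hT : Odd W.tamagawaProduct)
    (hoff : ¬ ∃ v : HeightOneSpectrum (𝓞 ℚ), ((2 : ℕ) : 𝓞 ℚ) ∉ v.asIdeal ∧ ((W.conductorNorm ℤ : ℕ) : 𝓞 ℚ) ∈ v.asIdeal ∧
      W.HasMultiplicativeReductionAt v)
    (hΔ : W.Δ < 0) (hsurj : W.HasSurjectiveModNGaloisRep 2) (hsurj4 : W.HasSurjectiveModNGaloisRep 4)
    {ξ : galH1Torsion W (2 : ℤ)} (hξ0 : ξ ≠ 0) (hξ4 : ∀ h ∈ torsionFixing W (4 : ℤ), h1Eval W (2 : ℤ) ξ h = 0)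
    (hξS : ξ ∈ W.selmerGroup 2)
    (hK : IsImaginaryQuadratic K) (hodd : Odd (discr K)) (hH : SatisfiesHeegnerHypothesis (W.conductorNorm ℤ) K)
    (h2K : ((Ideal.span {(2 : ℤ)}).primesOver (𝓞 K)).ncard = 2)
    {ℓ₀ : ℕ} (hℓ₀ : ℓ₀.Prime) (hd : discr K = -(ℓ₀ : ℤ)) (hP : (4 : ℤ) ∣ W.frobeniusTrace ℓ₀)
    {D : ℤ} (hD : D ≠ 0) (h8 : (8 : ℤ) ∣ D - 1)
    (hdeep : ∀ (ℓ : ℕ), ℓ.Prime → ℓ ≠ 2 → (ℓ : ℤ) ∣ D →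
      ℓ ≠ ℓ₀ ∧ ¬ ℓ ∣ W.conductorNorm ℤ ∧ FrobEqFrobInfty W K 2 ℓ ∧ 2 ≤ Zhang2014.kolyvaginIndex W 2 ℓ)
    (Wd' : WeierstrassCurve ℚ) [Wd'.IsElliptic] {C : VariableChange ℚ}
    (hWd' : C • W.quadraticTwist ((-(ℓ₀ : ℤ) * D : ℤ) : ℚ) = Wd') (hr : Wd'.mordellWeilRank = 0) :
    2 ≤ Nat.card (Wd'.sha ⊓ AddSubgroup.torsionBy Wd'.galH1 2 : AddSubgroup Wd'.galH1) := by
  have hD0 : ((-(ℓ₀ : ℤ) * D : ℤ) : ℚ) ≠ 0 := by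
    exact_mod_cast mul_ne_zero (neg_ne_zero.mpr (by exact_mod_cast hℓ₀.ne_zero)) hD
  exact two_le_natCard_sha_inf_torsionBy_of_hasSurjectiveModNGaloisRep_two Wd'
    (hasSurjectiveModNGaloisRep_two_of_smul_quadraticTwist W hsurj hD0 Wd' hWd') hr
    (two_le_natCard_selmerGroup_frameTwist_of_phantom_selmer_of_kolyvaginPrimes W hT hoff hΔ hsurj hsurj4 hξ0 hξ4 hξS hK hodd hH h2K
      hℓ₀ hd hP hD h8 hdeep Wd' hWd')

end Summit.BirchSwinnertonDyer.BirchSwinnertonDyer.Theorems.GenusExact.PhantomDescentBit.DeepTwist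

end
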